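/-
Copyright: lit-balaban Phase-2 proof seat p09 (gen 8).  Statement-level skeleton of a published paper; no proof claims beyond what the
kernel checks below.
-/
import Literature.MathematicalPhysics.QuantumFieldTheory.BalabanImbrieJaffe1984to88.BIJ85Ineq723TorusCE
import Literature.MathematicalPhysics.QuantumFieldTheory.BalabanImbrieJaffe1984to88.BIJ88Eq210Torus

/-!
# `BalabanImbrieJaffe1984to88.BIJ88ClocFactorsTorus` — T. Bałaban, J. Imbrie, A. Jaffe, *Effective action and cluster properties of the
abelian Higgs model*, Commun. Math. Phys. **114** (1988) 257–315 [BalabanImbrieJaffe1988], p. 261 [PDF 5]: the two SANDWICH FACTORS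
`1 − Q^{s*}Q`, `1 − Q*Q^s` of the localized covariance **(2.9)** on the tori of the series — LOCAL (range two blocks) and ℓ¹-BOUNDED, with the
support / ℓ¹ lemmas for the four kernels `Q` (2.13), `Q*` (2.14), `Q^s` (2.16), `Q^{s*}` (2.17) of [BalabanImbrieJaffe1985] — and the
*"like C^{(k)}"* half of **(2.10)**: **`QC^{(k)} = C^{(k)}Q* = 0` FOR THE `C^{(k)}` OF RECORD ITSELF**, no hypothesis (file 1 of 2; file 2
`BIJ88ClocEstimatesTorus` = the p. 261 sentence «We have estimates analogous to (2.5)–(2.7) for C^{(k)}_{loc}»)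

statement-level skeleton of published theorems with citation tags; proofs where landed; nothing here is a claim about the Yang–Mills mass gap

PDF held: `paper:balaban1988-cmp114-bij-abelian-higgs-effective-action` (journal page = PDF page + 256); pp. 260–261 [PDF 4–5] re-read this session
from the text layer (`lit read … --pages 3-6`, files `p0004.txt`–`p0006.txt`); [2] = [BalabanImbrieJaffe1985] pp. 304–305.

CITATION HEADER (lean-in-tree rule).  Part of the lit-balaban TYPED SKELETON (HOME `run/shared/lean/pub/lit-balaban/`), Phase 2, seat p09 GEN 8
(unit `lit-balaban-p09`; free-target protocol G.5-34(d), TAKING line HOME/STATUS.md 2026-08-21T20:22:32Z); rows **C2.Eq2.9 / C2.Eq2.10** of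
`HOME/SKELETON.md` (C2 §§1–4 fold owner r18, referee ref-5); the kernel lemmas of §1 are the *"support/sup lemmas for qKer/qstKer/qsKer/qsstKer on
torusBlockBonds"* named in p08 g8's HANDOFF (for the 𝒟_{k,loc} of (2.12)).  Decls used BY NAME: p31's `BIJ85Eq213Adjoint.qKer`/`qstKer`/
`bondAvg_eq_sum_qKer`/`runCount`, p02's `BIJ88Eq211Proof.qsKer`/`qsstKer`/`embLU`/`embUL`/`embUU`, gen 1's `BIJ85Eq219Proof.torusBlockBonds`/
`mem_Bs_iff`, r15's `BlockBonds.Bs_unique`, p11's `BIJ85Prop522Torus.CE`, p30's `BIJ85Eq611Landau.CE_eq_unitPropagator`, gen 2's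
`unitPropagator_symm`, gen 3's `BIJ85Ineq434Proof.axialPropagator_mem`, gen 6's `BIJ85Ineq723Torus.noZeroModes_step`/`supDist_le_of_blockOf_eq`,
gen 4's `BIJ85Ineq722Torus.supDist_runSite_le`/`supDist_triangle`, r18's `BIJ88Sect2Statements.Eq210`.

THE PRINTED TEXT (verbatim, p. 261 [PDF 5]).  *"Then put C^{(k)}_{loc} = (I − Q^{s*}Q)C̃^{(k)}(I − Q*Q^s); (2.9) this insures that C^{(k)}_{loc}, like
C^{(k)}, satisfies the constraints from the renormalization transformation and from the axial gauge conditions: QC^{(k)}_{loc} = C^{(k)}_{loc}Q* = 0,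
(2.10) … (See [2, Chap. 2] for definitions of the block averaging operators Q, Q^s, and Q^e.)"*  (p31's `BIJ88Eq210Torus` proves (2.10) for
`C^{(k)}_{loc}` and every `C̃`, saying verbatim *"that C^{(k)} itself satisfies the constraints … not touched"* — that half is §3 here.)

THE OBJECTS (tori of `Balaban1983to89.Setup`; fine bonds `PBond P j` = the unit lattice `T₁^{(k)}` of the k-th step field, coarse bonds `PBond P (j+1)`;
standing range `j + 1 ≤ m + K`; `|b − b′|` := `supDist b₋ b′₋`, the `ℓ^∞` torus distance of the sources as in the (7.2.3) files — `distB`):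
`Lfac P j = 1 − Q^{s*}Q`, `Rfac P j = 1 − Q*Q^s` (matrices on `PBond P j`); `Cmat P j` — THE MATRIX OF THE `C^{(k)}` OF RECORD, `C(b,b′) =
⟨e_b, C^{(j)}e_{b′}⟩` for p11's `CE P (η_j^d) (L^j) j` (= `unitPropagator (V411 P j) (curlOp …) (QsE P j) (Wstep P j)`), the object of gen 6's (7.2.3)
`BIJ85Ineq723TorusCE.ineq723_CE`.

WHAT IS PROVED (0 `sorry`, standard axioms, no named facts).
* §1 kernel geometry: `qKer_nonneg`, `bondAvg_const_one`, **`sum_qKer_eq_one`** (`Σ_b Q(c,b) = 1`), `exists_runBond_of_qKer_ne_zero`,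
  **`supDist_le_of_qKer_ne_zero`** (`b ∈ B^s(c)`, `Q(c,u) ≠ 0 ⇒ |b₋ − u₋| ≤ 2(L − 1)`), `qsstKer_eq_of_mem`/`_eq_zero_of_not_mem`/`_nonneg`,
  **`sum_abs_qsstKer_le`** (`≤ L`), `qsKer_eq_of_mem`/`_eq_zero_of_not_mem`/`_nonneg`, **`sum_qsKer_le`** (`≤ L^{−(d−1)}`), `qstKer_nonneg`,
  **`sum_qstKer_eq`** (`Σ_b Q*(b,c) = L^d`); the distance `distB` with `distB_comm`/`distB_self`/`distB_nonneg`.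
* §2 the factors: ranges **`distB_le_of_Lfac_ne_zero`**, **`distB_le_of_Rfac_ne_zero`** (`≠ 0 ⇒ |b − u| ≤ 2L`), ℓ¹ bounds **`Lfac_row_le`**,
  **`Rfac_col_le`** (`≤ 1 + L`) — uniform in `j` and in the volume.
* §3 **(2.10) FOR `C^{(k)}` ITSELF**: `CE_mem_Wstep` (range `C^{(k)} ⊆ δ(QB)δ_{Ax}(B)`), `bondAvg_CE_apply`, `Cmat_apply`, `Cmat_symm` (`d ≥ 2`,
  `j + 1 ≤ m + K`; no zero modes), **`qKer_mul_Cmat`** (`QC^{(k)} = 0`, every scale), **`Cmat_mul_qstKer`** (`C^{(k)}Q* = 0`, via `Q* = L^dQᵀ` and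
  symmetry), and r18's typed ring form **`eq210_C_torus : Eq210 (embLU Q) (embUL Q*) (embUU C)`** (companion of p31's `eq210_torus`).
HONEST SCOPE.  Torus (periodic b.c.), U(1), real fields; `Cmat_symm`/`Cmat_mul_qstKer`/`eq210_C_torus` need `d ≥ 2` and `j + 1 ≤ m + K` (the
range of `noZeroModes_step`), `qKer_mul_Cmat` holds at every scale; the geometry lemmas need `j + 1 ≤ m + K` (blocks tile the torus).  Four `def`s
with bodies (`distB`, `Lfac`, `Rfac`, `Cmat`), no `def … : Prop`, no new named fact (D-0026).  NOTHING beyond the kernel-checked statements is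
asserted; NOT summit progress.  Unit `lit-balaban-p09` (literature-prover-lit-balaban-p09-g8-0), 2026-08-21.
-/

namespace Literature.MathematicalPhysics.QuantumFieldTheory.BalabanImbrieJaffe1984to88.BIJ88ClocFactorsTorus

open Literature.MathematicalPhysics.QuantumFieldTheory.Balaban1983to89
open scoped BigOperators Matrix RealInnerProductSpace
open LatticeFieldCalculus BIJ85Sect2SurfaceAverages BIJ85Eq219Proof BIJ85Eq213Adjoint BIJ88Eq211Proof
open BIJ88Sect2Statements (Eq210)
open BIJ85AxialPropagator411 (curlOp V411)
open BIJ85UnitPropagator433 (unitPropagator unitPropagator_symm)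
open BIJ85Prop521Torus (CoarseSpace toEj QsE Wstep mem_Wstep)
open BIJ85Prop522Torus (CE)
open BIJ85Ineq723TorusCE (toEj_single inner_toEj_single_left)

noncomputable section

/-! ## §1  The geometry of the four kernels `Q`, `Q*`, `Q^s`, `Q^{s*}` on the tori: supports and ℓ¹ sums -/

section TorusKernels

variable {P : Params} {j : ℕ}

/-- `Q(c,b) ≥ 0` ((2.13) is an average with nonnegative weights). [cite: BalabanImbrieJaffe1985, (2.13) p.304] -/
theorem qKer_nonneg (c : PBond P (j + 1)) (b : PBond P j) : 0 ≤ qKer P j c b := by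
  unfold qKer
  positivity

/-- the straight contour of `L` bonds carries total weight `L` for the constant field `1`. [cite: BalabanImbrieJaffe1985, (2.13) p.304] -/
theorem segSum_const_one (x : Balaban1983to89.Site P j) (μ : Fin P.d) (n : ℕ) :
    segSum (fun _ : PBond P j => (1 : ℝ)) x μ n = n := by
  simp [segSum]

/-- `Q1 = 1`: the average (2.13) of the constant bond field `1` is `1` (`L^{−(d+1)}·L^d·L`). [cite: BalabanImbrieJaffe1985, (2.13) p.304] -/
theorem bondAvg_const_one (c : PBond P (j + 1)) : bondAvg (fun _ : PBond P j => (1 : ℝ)) c = 1 := by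
  unfold bondAvg
  simp only [segSum_const_one, Finset.sum_const, Finset.card_univ, Fintype.card_fun, Fintype.card_fin, smul_eq_mul, nsmul_eq_mul]
  have hL : (P.L : ℝ) ≠ 0 := Nat.cast_ne_zero.mpr P.L_pos.ne'
  rw [pow_succ]
  push_cast
  field_simp

/-- **the rows of `Q` sum to one**: `Σ_b Q(c,b) = 1` for every coarse bond `c`. [cite: BalabanImbrieJaffe1985, (2.13) p.304] -/
theorem sum_qKer_eq_one (c : PBond P (j + 1)) : ∑ b, qKer P j c b = 1 := by
  have h := bondAvg_eq_sum_qKer (fun _ : PBond P j => (1 : ℝ)) c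
  simp only [mul_one] at h
  rw [← h, bondAvg_const_one]

/-- the support of `Q(c, ·)`: `Q(c,b) ≠ 0` only if `b` is a bond of one of the straight contours `[x, x + Le_μ]`, `x ∈ B(c₋)`, of (2.13).
[cite: BalabanImbrieJaffe1985, (2.13) p.304] -/
theorem exists_runBond_of_qKer_ne_zero {c : PBond P (j + 1)} {b : PBond P j} (h : qKer P j c b ≠ 0) :
    ∃ (r : Fin P.d → Fin P.L) (t : ℕ), t < P.L ∧ runBond (Balaban1983to89.Site.blockSite c.src r) c.dir t = b := by
  classical
  have h' : runCount c b ≠ 0 := by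
    intro h0
    apply h
    unfold qKer
    rw [h0, Nat.cast_zero, mul_zero]
  unfold runCount at h'
  obtain ⟨r, -, hr⟩ := Finset.exists_ne_zero_of_sum_ne_zero h'
  obtain ⟨t, ht, hrt⟩ := Finset.exists_ne_zero_of_sum_ne_zero hr
  refine ⟨r, t, Finset.mem_range.1 ht, ?_⟩
  by_contra hne
  exact hrt (if_neg hne)

/-- **the range of `Q` seen from a surface bond**: if `b ∈ B^s(c)` and `Q(c,u) ≠ 0` then `|b₋ − u₋|_∞ ≤ 2(L − 1)` (`b₋` and the start `x` of the
contour through `u` lie in the block `B(c₋)` — at most `L − 1` apart — and `u₋ = x + te_μ`, `t < L`). [cite: BalabanImbrieJaffe1985, (2.15) p.304] -/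
theorem supDist_le_of_qKer_ne_zero (hj : j + 1 ≤ P.m + P.K) {c : PBond P (j + 1)} {b u : PBond P j}
    (hb : b ∈ (torusBlockBonds P j).Bs c) (hu : qKer P j c u ≠ 0) : supDist b.src u.src ≤ 2 * (P.L - 1) := by
  obtain ⟨r, t, ht, rfl⟩ := exists_runBond_of_qKer_ne_zero hu
  have hbsrc : blockOf b.src = c.src := ((mem_Bs_iff c b).1 hb).1
  have hx : blockOf (Balaban1983to89.Site.blockSite c.src r) = c.src := Balaban1983to89.Site.blockOf_blockSite hj c.src r
  have h1 : supDist b.src (Balaban1983to89.Site.blockSite c.src r) ≤ P.L - 1 :=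
    BIJ85Ineq723Torus.supDist_le_of_blockOf_eq hj (hbsrc.trans hx.symm)
  have h2 : supDist (Balaban1983to89.Site.blockSite c.src r) (runSite (Balaban1983to89.Site.blockSite c.src r) c.dir t) ≤ t :=
    BIJ85Ineq722Torus.supDist_runSite_le _ _ _
  have h3 := BIJ85Ineq722Torus.supDist_triangle b.src (Balaban1983to89.Site.blockSite c.src r)
    (runSite (Balaban1983to89.Site.blockSite c.src r) c.dir t)
  show supDist b.src (runSite (Balaban1983to89.Site.blockSite c.src r) c.dir t) ≤ 2 * (P.L - 1)
  omega

/-- (2.17): `Q^{s*}(b,c) = L` for `b ∈ B^s(c)`. [cite: BalabanImbrieJaffe1985, (2.17) p.304] -/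
theorem qsstKer_eq_of_mem {b : PBond P j} {c : PBond P (j + 1)} (h : b ∈ (torusBlockBonds P j).Bs c) :
    qsstKer (torusBlockBonds P j) b c = P.L := by
  simp [qsstKer, h]

/-- (2.17): `Q^{s*}(b,c) = 0` for `b ∉ B^s(c)`. [cite: BalabanImbrieJaffe1985, (2.17) p.304] -/
theorem qsstKer_eq_zero_of_not_mem {b : PBond P j} {c : PBond P (j + 1)} (h : b ∉ (torusBlockBonds P j).Bs c) :
    qsstKer (torusBlockBonds P j) b c = 0 := by
  simp [qsstKer, h]

/-- `Q^{s*}(b,c) ≥ 0`. [cite: BalabanImbrieJaffe1985, (2.17) p.304] -/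
theorem qsstKer_nonneg (b : PBond P j) (c : PBond P (j + 1)) : 0 ≤ qsstKer (torusBlockBonds P j) b c := by
  unfold qsstKer
  split_ifs <;> positivity

/-- **the rows of `Q^{s*}` have ℓ¹-norm `≤ L`**: a fine bond lies in the surface set of at most one coarse bond (`BlockBonds.Bs_unique`).
[cite: BalabanImbrieJaffe1985, (2.17) p.304] -/
theorem sum_abs_qsstKer_le (b : PBond P j) : ∑ c, |qsstKer (torusBlockBonds P j) b c| ≤ P.L := by
  by_cases h : ∃ c, b ∈ (torusBlockBonds P j).Bs c
  · obtain ⟨c₀, hc₀⟩ := h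
    rw [Finset.sum_eq_single c₀]
    · rw [qsstKer_eq_of_mem hc₀, Nat.abs_cast]
    · intro c _ hc
      rw [qsstKer_eq_zero_of_not_mem (fun hbc => hc ((torusBlockBonds P j).Bs_unique hbc hc₀)), abs_zero]
    · intro hc
      exact absurd (Finset.mem_univ _) hc
  · push Not at h
    rw [Finset.sum_eq_zero (fun c _ => by rw [qsstKer_eq_zero_of_not_mem (h c), abs_zero])]
    exact Nat.cast_nonneg _

/-- (2.16): `Q^s(c,b) = L^{−(d−1)}` for `b ∈ B^s(c)`. [cite: BalabanImbrieJaffe1985, (2.16) p.304] -/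
theorem qsKer_eq_of_mem {b : PBond P j} {c : PBond P (j + 1)} (h : b ∈ (torusBlockBonds P j).Bs c) :
    qsKer (torusBlockBonds P j) c b = ((P.L : ℝ) ^ (P.d - 1))⁻¹ := by
  simp [qsKer, h]

/-- (2.16): `Q^s(c,b) = 0` for `b ∉ B^s(c)`. [cite: BalabanImbrieJaffe1985, (2.16) p.304] -/
theorem qsKer_eq_zero_of_not_mem {b : PBond P j} {c : PBond P (j + 1)} (h : b ∉ (torusBlockBonds P j).Bs c) :
    qsKer (torusBlockBonds P j) c b = 0 := by
  simp [qsKer, h]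

/-- `Q^s(c,b) ≥ 0`. [cite: BalabanImbrieJaffe1985, (2.16) p.304] -/
theorem qsKer_nonneg (c : PBond P (j + 1)) (b : PBond P j) : 0 ≤ qsKer (torusBlockBonds P j) c b := by
  unfold qsKer
  split_ifs <;> positivity

/-- **the columns of `Q^s` have ℓ¹-norm `≤ L^{−(d−1)}`** (at most one coarse bond sees `b`). [cite: BalabanImbrieJaffe1985, (2.16) p.304] -/
theorem sum_qsKer_le (b : PBond P j) : ∑ c, qsKer (torusBlockBonds P j) c b ≤ ((P.L : ℝ) ^ (P.d - 1))⁻¹ := by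
  by_cases h : ∃ c, b ∈ (torusBlockBonds P j).Bs c
  · obtain ⟨c₀, hc₀⟩ := h
    rw [Finset.sum_eq_single c₀]
    · rw [qsKer_eq_of_mem hc₀]
    · intro c _ hc
      exact qsKer_eq_zero_of_not_mem (fun hbc => hc ((torusBlockBonds P j).Bs_unique hbc hc₀))
    · intro hc
      exact absurd (Finset.mem_univ _) hc
  · push Not at h
    rw [Finset.sum_eq_zero (fun c _ => qsKer_eq_zero_of_not_mem (h c))]
    positivity

/-- `Q*(b,c) = L^dQ(c,b) ≥ 0`. [cite: BalabanImbrieJaffe1985, (2.14) p.304] -/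
theorem qstKer_nonneg (b : PBond P j) (c : PBond P (j + 1)) : 0 ≤ qstKer P j b c := by
  unfold qstKer
  exact mul_nonneg (by positivity) (qKer_nonneg c b)

/-- **the columns of `Q*` sum to `L^d`**: `Σ_b Q*(b,c) = L^d Σ_b Q(c,b) = L^d` (the volume factor of (2.14)). [cite: BalabanImbrieJaffe1985, (2.14) p.304] -/
theorem sum_qstKer_eq (c : PBond P (j + 1)) : ∑ b, qstKer P j b c = (P.L : ℝ) ^ P.d := by
  simp only [qstKer]
  rw [← Finset.mul_sum, sum_qKer_eq_one, mul_one]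

/-- the length `|b − b′| := |b₋ − b′₋|_∞` (the `ℓ^∞` torus distance of the sources, in `T₁^{(k)}` units) in which the (7.2.3) files state the
decay of `C^{(k)}`; our reading of the `dist(b₁,b₂)` of (2.8). [cite: BalabanImbrieJaffe1988, (2.8) p.261] -/
def distB (P : Params) (j : ℕ) : PBond P j → PBond P j → ℝ := fun b b' => (supDist b.src b'.src : ℝ)

/-- `distB` unfolded. [cite: BalabanImbrieJaffe1988, (2.8) p.261] -/
theorem distB_apply (b b' : PBond P j) : distB P j b b' = (supDist b.src b'.src : ℝ) := rfl

/-- `distB` is symmetric (API of the (2.8) distance). [cite: BalabanImbrieJaffe1988, (2.8) p.261] -/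
theorem distB_comm (b b' : PBond P j) : distB P j b b' = distB P j b' b := by
  rw [distB_apply, distB_apply, B3TorusRadialSums.supDist_comm]

/-- `distB b b = 0` (API of the (2.8) distance). [cite: BalabanImbrieJaffe1988, (2.8) p.261] -/
theorem distB_self (b : PBond P j) : distB P j b b = 0 := by
  rw [distB_apply, (B3TorusRadialSums.supDist_eq_zero_iff _ _).2 rfl, Nat.cast_zero]

/-- `distB ≥ 0` (API of the (2.8) distance). [cite: BalabanImbrieJaffe1988, (2.8) p.261] -/
theorem distB_nonneg (b b' : PBond P j) : 0 ≤ distB P j b b' := Nat.cast_nonneg _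

end TorusKernels

/-! ## §2  The two sandwich factors of (2.9): `1 − Q^{s*}Q` and `1 − Q*Q^s` are local and ℓ¹-bounded -/

section Factors

variable {P : Params} {j : ℕ} [DecidableEq (PBond P j)]

variable (P j) in
/-- the left factor `1 − Q^{s*}Q` of (2.9), as a matrix on the unit-lattice bonds of the torus. [cite: BalabanImbrieJaffe1988, (2.9) p.261] -/
def Lfac : Matrix (PBond P j) (PBond P j) ℝ := 1 - qsstKer (torusBlockBonds P j) * qKer P j

variable (P j) in
/-- the right factor `1 − Q*Q^s` of (2.9), as a matrix on the unit-lattice bonds of the torus. [cite: BalabanImbrieJaffe1988, (2.9) p.261] -/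
def Rfac : Matrix (PBond P j) (PBond P j) ℝ := 1 - qstKer P j * qsKer (torusBlockBonds P j)

omit [DecidableEq (PBond P j)] in
/-- the absolute row sums of the identity matrix are `1`. [folklore] -/
private theorem sum_abs_one_row [DecidableEq (PBond P j)] (b : PBond P j) :
    ∑ u, |(1 : Matrix (PBond P j) (PBond P j) ℝ) b u| = 1 := by
  rw [Finset.sum_eq_single b]
  · rw [Matrix.one_apply_eq, abs_one]
  · intro u _ hub
    rw [Matrix.one_apply_ne (Ne.symm hub), abs_zero]
  · intro hb
    exact absurd (Finset.mem_univ _) hb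

omit [DecidableEq (PBond P j)] in
/-- the absolute column sums of the identity matrix are `1`. [folklore] -/
private theorem sum_abs_one_col [DecidableEq (PBond P j)] (b : PBond P j) :
    ∑ u, |(1 : Matrix (PBond P j) (PBond P j) ℝ) u b| = 1 := by
  rw [Finset.sum_eq_single b]
  · rw [Matrix.one_apply_eq, abs_one]
  · intro u _ hub
    rw [Matrix.one_apply_ne hub, abs_zero]
  · intro hb
    exact absurd (Finset.mem_univ _) hb

/-- **the left factor is local**: `(1 − Q^{s*}Q)(b,u) ≠ 0 ⇒ |b − u| ≤ 2L` (`u = b`, or `b ∈ B^s(c)` and `u` on a contour of `c` for some coarse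
`c`: `supDist_le_of_qKer_ne_zero`). [cite: BalabanImbrieJaffe1988, (2.9) p.261] -/
theorem distB_le_of_Lfac_ne_zero (hj : j + 1 ≤ P.m + P.K) {b u : PBond P j} (h : Lfac P j b u ≠ 0) :
    distB P j b u ≤ 2 * (P.L : ℝ) := by
  by_cases hbu : b = u
  · subst hbu
    rw [distB_self]
    positivity
  · have h' : (qsstKer (torusBlockBonds P j) * qKer P j) b u ≠ 0 := by
      intro h0
      apply h
      rw [Lfac, Matrix.sub_apply, Matrix.one_apply_ne hbu, h0, sub_zero]
    rw [Matrix.mul_apply] at h'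
    obtain ⟨c, -, hc⟩ := Finset.exists_ne_zero_of_sum_ne_zero h'
    have hq : qKer P j c u ≠ 0 := fun h0 => hc (by rw [h0, mul_zero])
    have hs : qsstKer (torusBlockBonds P j) b c ≠ 0 := fun h0 => hc (by rw [h0, zero_mul])
    have hb : b ∈ (torusBlockBonds P j).Bs c := by
      by_contra hnot
      exact hs (qsstKer_eq_zero_of_not_mem hnot)
    have hle := supDist_le_of_qKer_ne_zero hj hb hq
    rw [distB_apply]
    have hL := P.L_pos
    have : ((supDist b.src u.src : ℕ) : ℝ) ≤ ((2 * (P.L - 1) : ℕ) : ℝ) := by exact_mod_cast hle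
    have h2 : ((2 * (P.L - 1) : ℕ) : ℝ) ≤ 2 * (P.L : ℝ) := by
      rw [Nat.cast_mul, Nat.cast_two, Nat.cast_sub (by omega), Nat.cast_one]
      linarith
    exact this.trans h2

/-- **the right factor is local**: `(1 − Q*Q^s)(v,b′) ≠ 0 ⇒ |v − b′| ≤ 2L` (`Q*(v,c) = L^dQ(c,v)`, `Q^s(c,b′) ≠ 0 ⇔ b′ ∈ B^s(c)`).
[cite: BalabanImbrieJaffe1988, (2.9) p.261] -/
theorem distB_le_of_Rfac_ne_zero (hj : j + 1 ≤ P.m + P.K) {v b' : PBond P j} (h : Rfac P j v b' ≠ 0) :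
    distB P j v b' ≤ 2 * (P.L : ℝ) := by
  by_cases hvb : v = b'
  · subst hvb
    rw [distB_self]
    positivity
  · have h' : (qstKer P j * qsKer (torusBlockBonds P j)) v b' ≠ 0 := by
      intro h0
      apply h
      rw [Rfac, Matrix.sub_apply, Matrix.one_apply_ne hvb, h0, sub_zero]
    rw [Matrix.mul_apply] at h'
    obtain ⟨c, -, hc⟩ := Finset.exists_ne_zero_of_sum_ne_zero h'
    have hqs : qsKer (torusBlockBonds P j) c b' ≠ 0 := fun h0 => hc (by rw [h0, mul_zero])
    have hqst : qstKer P j v c ≠ 0 := fun h0 => hc (by rw [h0, zero_mul])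
    have hq : qKer P j c v ≠ 0 := by
      intro h0
      apply hqst
      unfold qstKer
      rw [h0, mul_zero]
    have hb : b' ∈ (torusBlockBonds P j).Bs c := by
      by_contra hnot
      exact hqs (qsKer_eq_zero_of_not_mem hnot)
    have hle := supDist_le_of_qKer_ne_zero hj hb hq
    rw [distB_comm, distB_apply]
    have hL := P.L_pos
    have : ((supDist b'.src v.src : ℕ) : ℝ) ≤ ((2 * (P.L - 1) : ℕ) : ℝ) := by exact_mod_cast hle
    have h2 : ((2 * (P.L - 1) : ℕ) : ℝ) ≤ 2 * (P.L : ℝ) := by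
      rw [Nat.cast_mul, Nat.cast_two, Nat.cast_sub (by omega), Nat.cast_one]
      linarith
    exact this.trans h2

/-- **the left factor has absolute row sums `≤ 1 + L`**: `Σ_u |(1 − Q^{s*}Q)(b,u)| ≤ 1 + Σ_c Q^{s*}(b,c)·Σ_u Q(c,u) = 1 + Σ_c Q^{s*}(b,c) ≤ 1 + L`.
[cite: BalabanImbrieJaffe1988, (2.9) p.261] -/
theorem Lfac_row_le (b : PBond P j) : ∑ u, |Lfac P j b u| ≤ 1 + (P.L : ℝ) := by
  have h1 : ∀ u, |Lfac P j b u| ≤ |(1 : Matrix (PBond P j) (PBond P j) ℝ) b u| +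
      ∑ c, qsstKer (torusBlockBonds P j) b c * qKer P j c u := by
    intro u
    rw [Lfac, Matrix.sub_apply, Matrix.mul_apply]
    refine (abs_sub _ _).trans ?_
    rw [abs_of_nonneg (Finset.sum_nonneg fun c _ => mul_nonneg (qsstKer_nonneg b c) (qKer_nonneg c u))]
  calc ∑ u, |Lfac P j b u|
      ≤ ∑ u, (|(1 : Matrix (PBond P j) (PBond P j) ℝ) b u| + ∑ c, qsstKer (torusBlockBonds P j) b c * qKer P j c u) :=
        Finset.sum_le_sum fun u _ => h1 u
    _ = 1 + ∑ c, qsstKer (torusBlockBonds P j) b c * ∑ u, qKer P j c u := by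
        rw [Finset.sum_add_distrib, sum_abs_one_row, Finset.sum_comm]
        simp only [Finset.mul_sum]
    _ = 1 + ∑ c, qsstKer (torusBlockBonds P j) b c := by
        simp only [sum_qKer_eq_one, mul_one]
    _ ≤ 1 + (P.L : ℝ) := by
        have h := sum_abs_qsstKer_le (P := P) b
        rw [Finset.sum_congr rfl fun c _ => abs_of_nonneg (qsstKer_nonneg b c)] at h
        linarith

/-- **the right factor has absolute column sums `≤ 1 + L`**: `Σ_v |(1 − Q*Q^s)(v,b′)| ≤ 1 + Σ_c Q^s(c,b′)·Σ_v Q*(v,c) = 1 + L^d Σ_c Q^s(c,b′)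
≤ 1 + L^d·L^{−(d−1)} = 1 + L`. [cite: BalabanImbrieJaffe1988, (2.9) p.261] -/
theorem Rfac_col_le (b' : PBond P j) : ∑ v, |Rfac P j v b'| ≤ 1 + (P.L : ℝ) := by
  have h1 : ∀ v, |Rfac P j v b'| ≤ |(1 : Matrix (PBond P j) (PBond P j) ℝ) v b'| +
      ∑ c, qstKer P j v c * qsKer (torusBlockBonds P j) c b' := by
    intro v
    rw [Rfac, Matrix.sub_apply, Matrix.mul_apply]
    refine (abs_sub _ _).trans ?_
    rw [abs_of_nonneg (Finset.sum_nonneg fun c _ => mul_nonneg (qstKer_nonneg v c) (qsKer_nonneg c b'))]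
  have hL : (P.L : ℝ) ≠ 0 := Nat.cast_ne_zero.mpr P.L_pos.ne'
  have hpow : (P.L : ℝ) ^ P.d * ((P.L : ℝ) ^ (P.d - 1))⁻¹ = P.L := by
    have hd : (P.L : ℝ) ^ P.d = (P.L : ℝ) ^ (P.d - 1) * P.L := by
      rw [← pow_succ, Nat.sub_add_cancel P.hd]
    rw [hd]
    field_simp
  calc ∑ v, |Rfac P j v b'|
      ≤ ∑ v, (|(1 : Matrix (PBond P j) (PBond P j) ℝ) v b'| + ∑ c, qstKer P j v c * qsKer (torusBlockBonds P j) c b') :=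
        Finset.sum_le_sum fun v _ => h1 v
    _ = 1 + ∑ c, qsKer (torusBlockBonds P j) c b' * ∑ v, qstKer P j v c := by
        rw [Finset.sum_add_distrib, sum_abs_one_col, Finset.sum_comm]
        congr 1
        refine Finset.sum_congr rfl fun c _ => ?_
        rw [Finset.mul_sum]
        exact Finset.sum_congr rfl fun v _ => mul_comm _ _
    _ = 1 + (P.L : ℝ) ^ P.d * ∑ c, qsKer (torusBlockBonds P j) c b' := by
        simp only [sum_qstKer_eq]
        rw [Finset.mul_sum]
        exact congrArg _ (Finset.sum_congr rfl fun c _ => mul_comm _ _)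
    _ ≤ 1 + (P.L : ℝ) ^ P.d * ((P.L : ℝ) ^ (P.d - 1))⁻¹ := by
        gcongr
        exact sum_qsKer_le b'
    _ = 1 + (P.L : ℝ) := by rw [hpow]

end Factors

/-! ## §3  The matrix of the `C^{(k)}` of record, and (2.10) for `C^{(k)}` ITSELF -/

section CMatrix

variable {P : Params} {j : ℕ} [DecidableEq (PBond P j)]

variable (P j) in
/-- **the kernel of the `C^{(k)}` of record on the torus**: `C(b,b′) = ⟨e_b, C^{(j)}e_{b′}⟩` for p11's `CE P (η_j^d) (L^j) j` (the (4.3.3)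
propagator of [BalabanImbrieJaffe1985] at the native weights; `= (C^{(j)}e_{b′})(b)`, `Cmat_apply`) — the `C^{(k)}(b₁,b₂)` of (2.8).
[cite: BalabanImbrieJaffe1988, (2.8) p.261] -/
def Cmat : Matrix (PBond P j) (PBond P j) ℝ := fun b b' =>
  ⟪toEj P j (Pi.single b 1), CE P ((P.eta j) ^ P.d) ((P.L : ℝ) ^ j) j (toEj P j (Pi.single b' 1))⟫

/-- `C(b,b′) = (C^{(j)}e_{b′})(b)`. [cite: BalabanImbrieJaffe1988, (2.8) p.261] -/
theorem Cmat_apply (b b' : PBond P j) :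
    Cmat P j b b' = CE P ((P.eta j) ^ P.d) ((P.L : ℝ) ^ j) j (EuclideanSpace.single b' 1) b := by
  unfold Cmat
  rw [inner_toEj_single_left, toEj_single]

omit [DecidableEq (PBond P j)] in
/-- **`C^{(k)}` maps into the constraint subspace `δ(QB)δ_{Ax}(B)`** (`Wstep`): the (4.3.3) second moment is supported on the slice it is
the covariance of (gen 3's `axialPropagator_mem`). [cite: BalabanImbrieJaffe1985, (4.3.3) p.311] -/
theorem CE_mem_Wstep (w c : ℝ) (x : CoarseSpace P j) : CE P w c j x ∈ Wstep P j :=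
  BIJ85Ineq434Proof.axialPropagator_mem (Wstep P j) _ x

omit [DecidableEq (PBond P j)] in
/-- hence `Q(C^{(k)}x) = 0` for every source `x`: the block averages (2.13) of every column of `C^{(k)}` vanish.
[cite: BalabanImbrieJaffe1988, (2.10) p.261] -/
theorem bondAvg_CE_apply (w c : ℝ) (x : CoarseSpace P j) :
    bondAvg (fun b : PBond P j => CE P w c j x b) = 0 :=
  ((mem_Wstep j _).1 (CE_mem_Wstep w c x)).1

/-- **`QC^{(k)} = 0` ON THE TORUS** — the *"like C^{(k)}"* half of (2.10) for the renormalization constraint, as a product of the kernel (2.13)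
with the matrix of the `C^{(k)}` of record. [cite: BalabanImbrieJaffe1988, (2.10) p.261] -/
theorem qKer_mul_Cmat : qKer P j * Cmat P j = 0 := by
  ext c b'
  rw [Matrix.mul_apply, Matrix.zero_apply]
  simp_rw [Cmat_apply]
  rw [← bondAvg_eq_sum_qKer (fun b : PBond P j => CE P ((P.eta j) ^ P.d) ((P.L : ℝ) ^ j) j (EuclideanSpace.single b' 1) b) c]
  exact congrFun (bondAvg_CE_apply _ _ _) c

/-- **`C^{(k)}` is symmetric**: `C(b,b′) = C(b′,b)` (the second moment of a Gaussian; no zero modes of `∂H_{j,Ax}` on `Wstep`, gen 6's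
`noZeroModes_step`, `d ≥ 2`, `j + 1 ≤ m + K`). [cite: BalabanImbrieJaffe1985, (4.3.3) p.311] -/
theorem Cmat_symm (hd : 2 ≤ P.d) (hj : j + 1 ≤ P.m + P.K) (b b' : PBond P j) : Cmat P j b b' = Cmat P j b' b := by
  unfold Cmat
  rw [BIJ85Eq611Landau.CE_eq_unitPropagator,
    ← unitPropagator_symm _ _ _ _ (fun w hw => BIJ85Ineq723Torus.noZeroModes_step hd hj w hw), real_inner_comm]

/-- **`C^{(k)}Q* = 0` ON THE TORUS** — the other half of (2.10) for `C^{(k)}` itself: `(CQ*)(b,c) = L^d Σ_{b′} Q(c,b′)C(b′,b) = L^d(QC)(c,b) = 0`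
(`Q* = L^dQᵀ`, (2.14), and the symmetry of `C^{(k)}`). [cite: BalabanImbrieJaffe1988, (2.10) p.261] -/
theorem Cmat_mul_qstKer (hd : 2 ≤ P.d) (hj : j + 1 ≤ P.m + P.K) : Cmat P j * qstKer P j = 0 := by
  ext b c
  rw [Matrix.mul_apply, Matrix.zero_apply]
  have h := congrFun (congrFun (qKer_mul_Cmat (P := P) (j := j)) c) b
  rw [Matrix.mul_apply, Matrix.zero_apply] at h
  calc ∑ b', Cmat P j b b' * qstKer P j b' c = (P.L : ℝ) ^ P.d * ∑ b', qKer P j c b' * Cmat P j b' b := by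
        rw [Finset.mul_sum]
        refine Finset.sum_congr rfl fun b' _ => ?_
        rw [Cmat_symm hd hj b b']
        unfold qstKer
        ring
    _ = 0 := by rw [h, mul_zero]

open Classical in
/-- **(2.10) FOR `C^{(k)}` ITSELF, AS TYPED** (r18's ring-level `BIJ88Sect2Statements.Eq210`, in the ring of block matrices on `T₁-bonds ⊕ L-bonds`
with p02's embeddings `embLU`/`embUL`/`embUU` — the companion, for `C^{(k)}`, of p31's `BIJ88Eq210Torus.eq210_torus` for `C^{(k)}_{loc}`).
[cite: BalabanImbrieJaffe1988, (2.10) p.261] -/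
theorem eq210_C_torus (hd : 2 ≤ P.d) (hj : j + 1 ≤ P.m + P.K) :
    Eq210 (embLU (qKer P j)) (embUL (qstKer P j)) (embUU (Cmat P j)) := by
  constructor
  · simp [embLU, embUU, Matrix.fromBlocks_multiply, qKer_mul_Cmat]
  · simp [embUL, embUU, Matrix.fromBlocks_multiply, Cmat_mul_qstKer hd hj]

end CMatrix

end

end Literature.MathematicalPhysics.QuantumFieldTheory.BalabanImbrieJaffe1984to88.BIJ88ClocFactorsTorus
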